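import Summits.ResolutionOfSingularities.ResolutionOfSingularities.Theorems.HilbertSamuelEliminationSigmaMaxModificationsCorridor3SigmaCornerService
import Summits.ResolutionOfSingularities.ResolutionOfSingularities.Theorems.HilbertSamuelEliminationSigmaMaxModificationsCorridor3SigmaCornerRankImposed
import HarnessLib

/-!
# [OURS · L1 W4.2] `Corridor3SigmaCornerServiceVacuity` — §4c of `…Corridor3SigmaCornerService` (split for the 400-line lint): the VACUITY CERTIFICATE for the
# sketch's unrelativised `IsAdmissibleOracle`, and rows CORNER-SCHEDULE / CORNER-NEG RE-KEYED to admissibility ALONG THE RUN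

Typer res-L1-type-o1 (OURS typer G4; res-L1-w42-plan-1 RULINGS v3.14-11 (CL)(iii) / v3.14-11c (CR); TYPER VACUITY NOTE #2 2026-08-27T10:15:24Z). FINDING
(kernel-checked below): idea-2's `IsAdmissibleOracle O` (Sketch r7 §2, hosted verbatim in the sibling) quantifies its stopping and legal-centre clauses over
ALL `S : Stage 3 = List (Cone 3)`, including junk lists that no run ever meets; at the junk stage `[junkCone (2/5), junkCone (1/5)]` (same rays; one ACTIVE
board `(2/5,2/5,2/5)`; a companion board `(1/5,1/5,1/5)` admitting NO permissible slot set, and `Stage.LegalCentre` constrains every cone containing the face,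
active or not) the stopping clause forces `O S = some R` and the legal-centre clause is then unsatisfiable — for EVERY oracle `O`. Hence AS TYPED
`MaxRankServiceTerminates` is VACUOUSLY TRUE and `FairServiceCanDiverge` is FALSE for the trivial reason (same failure class as the unscoped
`IsAdmissibleStrategy` of the σ-layer, res-D-pv-047 09:51:53Z). The DESIGN is untouched (σ_ρ's runs from initial stages only meet coherent fan stages); the
intended content is carried by the re-keyed rows `MaxRankServiceTerminatesAlong` / `FairServiceCanDivergeAlong` over `IsAdmissibleOracleAlong O S₀`
(admissibility demanded only at the stages of `O`'s own run from `S₀`), and `sigmaRho_admissibleAlong_of_coherent` plugs the sibling's coherent-stage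
admissibility of `σ_ρ` into that shape; `not_imposedStaysBelow_row` records BY NAME that the hosted row `ImposedStaysBelow` is REFUTED (res-type-022's
kernel witness p523797). OURS (cell res-hironaka, slot W4.2); NOT statements of the manuscript [Hironaka2017] nor of [CossartJannsenSaito2020] /
[Spivakovsky1983]; AI typing, weaker than expert review; helper `--supports stmt-ResolutionOfSingularities-19249 --as helper` (counted 0).
-/

noncomputable section

set_option linter.dupNamespace false

namespace Summit.ResolutionOfSingularities.ResolutionOfSingularities.Cruxes.SigmaMaxModifications.IdeasL1Idea2R7

open Finset Literature.Combinatorics.HironakaPolyhedraGame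
open Summit.ResolutionOfSingularities.ResolutionOfSingularities.Theorems.SigmaMaxModificationsCorridor3.Sigma.CornerRank

section Vacuity

open Classical

variable {n : ℕ}

/-! ### §4c  VACUITY CERTIFICATE for the unrelativised `IsAdmissibleOracle`, and the rows RE-KEYED to admissibility ALONG THE RUN (typer; NEW) -/

/-- [OURS · L1 W4.2] **ADMISSIBILITY ALONG THE ORACLE'S OWN RUN from `S₀`** — the honest form of `IsAdmissibleOracle` (which quantifies over ALL
stages, including junk lists of cones, and is unsatisfiable, `not_isAdmissibleOracle_three`): at every stage the run from `S₀` visits, `O` stops iff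
no board is active and otherwise names a legal centre. NOT a statement of any manuscript. [folklore] -/
def IsAdmissibleOracleAlong (O : Oracle n) (S₀ : Stage n) : Prop :=
  ∀ k, (O (run O S₀ k) = none ↔ ∀ c ∈ run O S₀ k, ¬ c.Active) ∧ ∀ R, O (run O S₀ k) = some R → (run O S₀ k).LegalCentre R

/-- Unrelativised admissibility gives admissibility along every run (the converse is the point: it fails). [folklore] -/
theorem IsAdmissibleOracle.along {O : Oracle n} (h : IsAdmissibleOracle O) (S₀ : Stage n) : IsAdmissibleOracleAlong O S₀ :=
  fun k => h (run O S₀ k)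

/-- [OURS · L1 W4.2] **ROW CORNER-SCHEDULE, RE-KEYED** (`MaxRankServiceTerminates` with admissibility demanded ALONG THE RUN from the initial stage
only): an oracle serving at every step a board of maximal rank with a rank-optimal move, admissible along its own run from `initialStage A`,
terminates. OPEN (idea-2's model: 3532/3532 starts). [OURS · conjecture] -/
def MaxRankServiceTerminatesAlong : Prop :=
  ∀ σ : Finset (Fin 3 → ℚ) → Finset (Fin 3), (∀ A, IsPosition A → ¬ Won A → IsRankOptimal A (σ A)) →
    ∀ O : Oracle 3, ServesMaxRank O σ →
      ∀ A : Finset (Fin 3 → ℚ), IsPosition A → IsAdmissibleOracleAlong O (initialStage A) → Terminates O (initialStage A)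

/-- [OURS · L1 W4.2] **ROW CORNER-NEG, RE-KEYED** (`FairServiceCanDiverge` with admissibility along the run): a legal positional strategy winning
Hironaka's game from every 3-dimensional position, and an oracle serving it, admissible along its run from some initial trinomial stage, whose run
never terminates (witness of record: Spivakovsky's σ + round-robin from `((0,2,2),(3,1,3))/3`, idea-2 j274806 J9). [OURS · conjecture ← model] -/
def FairServiceCanDivergeAlong : Prop :=
  ∃ σ : Finset (Fin 3 → ℚ) → Finset (Fin 3),
    IsLegalStrategy σ ∧ (∀ A, IsPosition A → ¬ Won A → StrategyWinsFrom σ A) ∧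
    ∃ O : Oracle 3, Serves O σ ∧
      ∃ A : Finset (Fin 3 → ℚ), IsPosition A ∧ IsAdmissibleOracleAlong O (initialStage A) ∧ ¬ Terminates O (initialStage A)

/-- The JUNK CONE of the vacuity certificate: standard rays, the one-generator board `(q, q, q)`. [folklore] -/
def junkCone (q : ℚ) : Cone 3 :=
  ⟨fun i j => if i = j then 1 else 0, {fun _ => q}⟩

/-- The junk board `(2/5, 2/5, 2/5)` is ACTIVE (`Σ = 6/5 > 1`). [folklore] -/
theorem junkCone_active : (junkCone (2 / 5)).Active := by
  rintro ⟨a, ha, hsum⟩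
  simp only [junkCone, Finset.mem_singleton] at ha
  subst ha
  simp only [Finset.sum_const, Finset.card_univ, Fintype.card_fin, nsmul_eq_mul] at hsum
  norm_num at hsum

/-- No slot set is permissible at the junk board `(1/5, 1/5, 1/5)` (`Σ ≤ 3/5 < 1`). [folklore] -/
theorem not_isPermissible_junkCone (T : Finset (Fin 3)) : ¬ IsPermissible (junkCone (1 / 5)).pos T := by
  intro h
  have h1 := h (fun _ => (1 / 5 : ℚ)) (by simp [junkCone])
  simp only [Finset.sum_const, nsmul_eq_mul] at h1
  have hcard : (T.card : ℚ) ≤ 3 := by exact_mod_cast (Finset.card_le_univ T).trans_eq (Fintype.card_fin 3)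
  nlinarith

/-- **VACUITY CERTIFICATE: `IsAdmissibleOracle O` HOLDS FOR NO `O : Oracle 3`.** At the junk stage `[junkCone (2/5), junkCone (1/5)]` (same rays,
one active board whose companion board admits no permissible slot set) the stopping clause forces `O S = some R`, the legal-centre clause then
demands permissibility at the companion cone — impossible. Hence, AS TYPED in the sketch, `MaxRankServiceTerminates` is vacuously true and
`FairServiceCanDiverge` false; the re-keyed rows `…Along` above carry the intended content. [folklore] -/
theorem not_isAdmissibleOracle_three (O : Oracle 3) : ¬ IsAdmissibleOracle O := by
  intro hO
  obtain ⟨hstop, hlegal⟩ := hO [junkCone (2 / 5), junkCone (1 / 5)]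
  cases hOS : O [junkCone (2 / 5), junkCone (1 / 5)] with
  | none =>
    exact ((hstop.mp hOS) (junkCone (2 / 5)) (by simp)) junkCone_active
  | some R =>
    obtain ⟨-, ⟨c₀, hc₀, hcont, -⟩, hperm⟩ := hlegal R hOS
    -- every cone of the junk stage has the same rays, so the companion cone contains `R` too
    have hrays : c₀.ray = (junkCone (1 / 5)).ray := by
      simp only [List.mem_cons, List.not_mem_nil, or_false] at hc₀
      rcases hc₀ with rfl | rfl <;> rfl
    have hcont' : (junkCone (1 / 5)).Contains R := by
      intro r hr
      have := hcont hr
      rwa [hrays] at this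
    exact not_isPermissible_junkCone _ (hperm (junkCone (1 / 5)) (by simp) hcont')

/-- AS TYPED, `MaxRankServiceTerminates` is VACUOUSLY TRUE (its admissibility hypothesis is never met). [folklore] -/
theorem maxRankServiceTerminates_vacuous : MaxRankServiceTerminates :=
  fun _ _ O hO => absurd hO (not_isAdmissibleOracle_three O)

/-- AS TYPED, `FairServiceCanDiverge` is FALSE for the trivial reason (no admissible oracle exists). [folklore] -/
theorem not_fairServiceCanDiverge : ¬ FairServiceCanDiverge := by
  rintro ⟨σ, -, -, O, hO, -⟩
  exact not_isAdmissibleOracle_three O hO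

/-- `σ_ρ` is admissible ALONG any run all of whose stages are COHERENT (the form in which `MaxRankServiceTerminatesAlong` consumes it; coherence of
`run sigmaRho (initialStage A) k` is the fan / star-subdivision invariant, not proved here). [folklore] -/
theorem sigmaRho_admissibleAlong_of_coherent {S₀ : Stage 3} (hS : ∀ k, (run sigmaRho S₀ k).Coherent) :
    IsAdmissibleOracleAlong sigmaRho S₀ :=
  fun k => sigmaRho_admissibleAt_of_coherent (hS k)


/-- **ROW `ImposedStaysBelow` (hosted by name in the sibling) IS REFUTED** — by res-type-022's kernel witness `CornerRank.not_imposedStaysBelow`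
(p523797: `A = {(2/3,2/3,4/3)}`, `Γ = {0,2}`, `A' = {(2/3,1,4/3)}`, imposed child of rank `≥ 3`); the named `def` and the refuted inline statement are
the same proposition. [folklore] -/
theorem not_imposedStaysBelow_row : ¬ ImposedStaysBelow :=
  Summit.ResolutionOfSingularities.ResolutionOfSingularities.Theorems.SigmaMaxModificationsCorridor3.Sigma.CornerRank.not_imposedStaysBelow

end Vacuity

end Summit.ResolutionOfSingularities.ResolutionOfSingularities.Cruxes.SigmaMaxModifications.IdeasL1Idea2R7

end
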